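import Mathlib
import Literature.Analysis.FluidPDE.ClassicalSolution
import Literature.Analysis.FluidPDE.ClayClassLerayHopfUniqueness
import Literature.Analysis.FluidPDE.ClayForceLerayProjection
import Literature.Analysis.FunctionSpaces.SobolevDomain
import Literature.Claims.NS.ClayVariants
import HarnessLib

/-!
# Claim skeleton (D-0090 NS-CLAIMS, C09): Liu 2025 — global smooth NS solutions on `ℝ³` via the
# parabolic inertia Lamé system and the limit `λ → ∞`

Typed skeleton of Genqian Liu, *Existence of smooth solutions of the Navier–Stokes equations in
three-dimensional Euclidean space*, arXiv:2507.18063 **v3** (2025-10-20), 42 pp. (bib `LiuGenqian2025NSLame`;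
page and equation numbers below are those PRINTED in the v3 PDF — note that they differ from the TeX
labels and from v1: e.g. the bound of Theorem 4.3 is (4.16) on p. 22). UNREFEREED CLAIM under
adjudication — NOTHING in this file asserts a step of the paper: the paper's statements are
`def … : Prop`; the `theorem`s are kernel compositions of the paper's OWN implications
(`theorem43_of_steps`, `claim_of_steps`) and the Clay link (`clay_of_claimed`). Verdict vocabulary is
the refuter's / referee's.

## The claimed statement (Theorem 1.1, p. 2), as printed
"Take `µ > 0` and `n = 3`. Let `ϕ(x)` be any smooth, divergence-free vector field satisfying (1.4)
[`|∂^α ϕ(x)| ≤ C_{αM} (1+|x|)^{−M}`, = Clay (4)]. Take `f(x, t)` to be identically zero. Then there exist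
smooth functions `u_j(x, t)`, `p(x, t)` on `ℝⁿ × [0, ∞)` that satisfy (1.1), (1.2), (1.3) [NS with
viscosity `µ`, force `f`, datum `ϕ`], (1.6) [`p, u ∈ C^∞(ℝⁿ × [0,∞))`], (1.7) [`∫ |u|² dx < C` for all
`t ≥ 0`]. Moreover, the solution `(u, p)` is unique." Typed as `ClaimedTheorem` over the landed
`Literature.Claims.NS.ClayVariants.clayR3` vocabulary: existence = `clayR3.Solvable µ 0 ϕ`, uniqueness =
of the VELOCITY among Clay-sense solutions (smooth on `ℝ³ × [0,∞)`, bounded energy); the printed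
"`(u, p)` is unique" is false for `p` as written (`p + c(t)`) and is read for `u`. Theorem 1.2 (p. 4, the
periodic analogue, "with a completely similar method", no proof printed) is not typed.

## Clay delta
None at statement level: `clay_of_claimed : ClaimedTheorem → ClayVariants.clayR3.Regularity` is PROVED
below (existence half of Theorem 1.1 is Clay (A) token for token: Δ1 `ℝ³`, Δ3 `f ≡ 0`, Δ4 datum (4),
Δ5 `C^∞` + (7), Δ7 "Take `µ > 0`"; uniqueness is extra). Any failure is therefore inside the proof.

## The paper's architecture and the Steps (dependency order; `claim_of_steps` takes them in this order)
Route (pp. 2–4, §4–§5): local smooth solutions of the parabolic inertia Lamé system (1.8) = (4.1)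
`∂ₜu − µΔu − (λ+µ) grad div u + (u·∇)u = 0`, `u(0) = ϕ` (`µ > 0`, `λ + µ ≥ 0`); the "maximum principle"
Theorem 4.3 (sup bound with a constant depending only on `µ`); `H^k` energy inequalities; global Lamé
solutions for every `λ`; `λ_m → ∞` along a subsequence gives NS.
* Step 1 = `Theorem42` — THEOREM 4.2 (p. 20): local existence/uniqueness on `[0, T₀]`, `T₀` independent
  of `λ`, solution smooth on `ℝ³ × [0, T₀]` (proof pp. 20–21, contraction (4.5)–(4.11), using Thm 3.5).
* Step 2 = `HodgeSplit` — proof of Thm 4.3, step 1 (p. 22, (4.19)–(4.21)): Hodge decomposition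
  `ϕ = ϕ₁ + ϕ₂`, `div ϕ₁ = 0`, `curl ϕ₂ = 0`, `ϕ₁, ϕ₂ ∈ C₀ ∩ C^∞`.
* Step 3 = `Thm43NullSpace` — proof of Thm 4.3, step 2 (p. 25, the sentence "In view of
  `(PL)* = L*P* = L*P`, we see that the null-space of the operator `L*P` is just `V⁰`", used with (4.38),
  (4.39) to get (4.40) "`⟨PL(θ), η⟩ = 0` for all `η ∈ V⁰`"): every divergence-free field of the class
  (vanishing at `t = 0`, as in (4.38)) solves the adjoint equation `L*η = ∂ₜη + µΔη − (u·∇)η − (div u)η = 0`.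
  Second printed reading `Thm43NullSpaceV0` ((4.40): all `η ∈ V⁰`, no condition at `t = 0`; implies the
  first). Companion (cell rule F15): `Thm43NullSpaceAbstract`, the operator-theoretic sentence itself
  over an arbitrary real Hilbert space. (The symmetric step 3, pp. 25–28, (4.42)–(4.56), repeats it for `W⁰`.)
* Step 4 = `Thm43Decoupling` — proof of Thm 4.3, conclusion of steps 2–3 (p. 28, l. 1–3: "`f ≡ 0`";
  (4.57), (4.58); p. 29 l. 2–8: "we see `u = v + w`"): the Lamé solution splits as `u = v + w` with `v`
  solving the PRESSURELESS drift–diffusion system (4.57) (`∂ₜv − µΔv + (u·∇)v = 0`, `div v = 0`,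
  `v(0) = ϕ₁`) and `w` solving (4.58) (`∂ₜw − (λ+2µ)Δw + (u·∇)w = 0`, `curl w = 0`, `w(0) = ϕ₂`).
  Existential form of Steps 1 + 4 (p. 28 "there exist two vector fields"): `DecouplingExists`
  (`decouplingExists_of_steps`, `not_thm43Decoupling_of_not_decouplingExists`).
* Step 5 = `DriftHeatMaxPrinciple` — proof of Thm 4.3, step 4 (p. 28, (4.59)–(4.65)): sup-norm
  maximum principle for `∂ₜv − κΔv + (u·∇)v = 0`.
  RE-TYPED IN THE PRINT'S CLASS (hygiene revision 2026-08-27, last section of this file): the class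
  `IsDriftHeatSolutionOn` keeps only slice-wise `C₀` of the print's `v ∈ C¹([0,T]; C₀²(ℝ³))` (p. 28), which
  makes Step 5 as first typed wider than the paper; Step 4′ = `Thm43Decoupling'` and Step 5′ =
  `DriftHeatMaxPrinciple'` add the uniform-in-`t` vanishing at spatial infinity
  (`VanishesAtInfinityUniformlyOn`); Step 5′ is PROVED (`driftHeatMaxPrinciple'_holds`, the printed
  argument (4.61)–(4.64)); Step 4′ ⇒ Step 4 (`thm43Decoupling_of_primed`).
* Step 6 = `HodgeSupBound` — IMPLICIT in "Combining (4.19), (4.22)–(4.57), (4.59), (4.65), we get the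
  desired result (4.16)" (p. 29, l. 8–9): from `‖v‖ ≤ ‖ϕ₁‖_C`, `‖w‖ ≤ ‖ϕ₂‖_C` to `C‖ϕ‖_C` one needs
  `‖ϕ₁‖_C + ‖ϕ₂‖_C ≤ C‖ϕ‖_C` with a universal `C` (Hodge components bounded in sup norm by the field)
  — typed as the glue Step the sentence requires (cell TYPING-HYGIENE item 8); not printed.
* Step 7 = `Theorem43` — THEOREM 4.3 (p. 22, (4.16)): `‖u‖_{C(ℝ³×[0,T])} ≤ C‖ϕ‖_{C(ℝ³)}`, "the constant
  `C` is independent of `λ` and `T`, and depends only on `µ > 0`" — LOAD-BEARING: consumed by Lemma 4.5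
  (p. 29), Theorem 4.8 (p. 33, (4.89)), §5 (p. 34, (5.2); p. 37; uniqueness p. 39 (5.42)).
  `theorem43_of_steps : HodgeSplit → Thm43Decoupling → DriftHeatMaxPrinciple → HodgeSupBound → Theorem43`
  is PROVED (the printed proof of Thm 4.3 composes from its steps; `C = 2C₀`); in the print's class
  `theorem43_of_steps' : HodgeSplit → Thm43Decoupling' → HodgeSupBound → Theorem43` (Step 5′ being a
  theorem). Divergence-free-data reading: `Theorem43DivFree` (`theorem43DivFree_of_theorem43`).
* Step 8 = `Theorem46G` — THEOREM 4.6 (p. 29, (4.67)–(4.68): `d/dt ‖u‖²_{H^k} ≤ c_k ‖u‖²_∞ ‖u‖²_{H^k}`,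
  `c_k = c_k(µ, k)`), typed in the Gronwall-integrated form in which it is used ((4.91) p. 33, (5.4) p. 34,
  via Lemma 4.7 (4.85)).
* Step 9 = `Theorem48` — THEOREM 4.8 (p. 32; proof p. 33 from Thm 4.2, Lemma 4.5, Thm 4.3, Thm 4.6,
  Lemma 4.7): unique global smooth solution of (4.1) for every `λ ≥ −µ`.
* Step 10 = `Section5Existence` — §5, proof of Theorem 1.1, pp. 34–38 ((5.2)–(5.37): `λ`-uniform bounds,
  weak limits along `λ_{m_l} → ∞`, (5.32) the limit solves NS, (5.36) datum, smoothness "we will omit the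
  proof of this part" p. 38) and the energy bound (5.45)–(5.48) p. 39: typed as the printed implication
  from Steps 9, 7, 8 to Clay-sense solvability.
* Step 11 = `Section5Uniqueness` — §5, pp. 38–39, (5.38)–(5.44) ("From Theorem 4.3 and (5.41)"):
  uniqueness; typed within the class of Theorem 1.1 (smooth, bounded energy); the literal reading
  "if `(ũ, p̃)` is another solution of (5.37)" (no decay class) is `Section5UniquenessPrinted`.
COMPOSITION: proved as `claim_of_steps : Step 1 → … → Step 6 → Step 8 → … → Step 11 → ClaimedTheorem`
(Step 7 = `Theorem43` is not a hypothesis: it is DERIVED inside from Steps 2, 4, 5, 6 by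
`theorem43_of_steps`); it CONSUMES Steps 2, 4, 5, 6, 8, 9, 10, 11; Steps 1 and 3 are the printed support
of Steps 9 and 4 respectively (mathematics, not logic, links them) and are carried as hypotheses so that
the first failing step is locatable. Standalone refutation targets: every Step; `Theorem43` (p. 22).

## Typing conventions (cell TYPING-HYGIENE)
* Sup norms are typed in hypothesis form (`∀ M, (∀ x, ‖ϕ x‖ ≤ M) → … ≤ C * M`), never via `sSup`.
* "`ϕ ∈ 𝒮(ℝ³)`" = smooth with rapidly decaying derivatives = `ContDiff ℝ ∞ ϕ ∧ HasRapidSpatialDecay ϕ`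
  (the tree's Clay (4) predicate), which is (1.4).
* The solution class "`u ∈ C([0,T]; H^{m+1}(ℝ³) ∩ C₀(ℝ³)) ∩ C^∞(ℝ³ × [0,T])`, `m > 3/2`" is typed as:
  jointly `C^∞` on the closed slab (tree `IsSmoothSpaceTimeOn`), every slice in `W^{m+1,2}(ℝ³)`
  (tree `MemSobolevDomain`) and in `C₀`, `m : ℕ` with `2 ≤ m`; continuity in `t` for the `H^{m+1}` norm is
  not typed separately (recorded deviation); continuity in `t` into `C₀` enters only Steps 4′/5′, as the
  uniform-in-`t` vanishing clause `VanishesAtInfinityUniformlyOn` (explicit quantifiers, no suprema).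
  Time derivatives are one-sided within `[0,T]` (tree `timeDerivWithin`), as in the tree's classical NS
  predicate.
* `H^k` norms are the tree's extended Sobolev norms `eSobolevDomainNorm k 2 ⊤ volume` (values in `ℝ≥0∞`,
  no junk).

WHAT THIS IS NOT: not a claim about NS regularity or blow-up; not a claim about any author beyond the typed
locator.
-/

noncomputable section

open MeasureTheory TopologicalSpace Set Function Real Filter
open scoped Laplacian InnerProductSpace RealInnerProductSpace ENNReal ContDiff Topology

namespace Literature.Claims.NS.Liu2025

open Literature.Analysis.FluidPDE Literature.Analysis.FunctionSpaces

/-! ## Vocabulary -/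

/-- Physical space `ℝ³` (plumbing abbreviation). [folklore] -/
abbrev E3 : Type := EuclideanSpace ℝ (Fin 3)

/-- "`ϕ ∈ 𝒮(ℝ³)`" / condition (1.4): `ϕ` smooth with `|∂^α ϕ(x)| ≤ C_{αM}(1+|x|)^{−M}` for all `α, M`
— the tree's Clay (4) predicate `HasRapidSpatialDecay` plus smoothness. [cite: LiuGenqian2025NSLame, (1.4) p.1] -/
def IsSchwartzField (φ : E3 → E3) : Prop :=
  ContDiff ℝ ∞ φ ∧ HasRapidSpatialDecay φ

/-- `C₀(ℝ³)`: "`|f(x)| → 0` as `|x| → +∞`" (Lemma 4.1, p. 20). [cite: LiuGenqian2025NSLame, Lemma 4.1 p.20] -/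
def VanishesAtInfinity {F : Type*} [NormedAddCommGroup F] (g : E3 → F) : Prop :=
  Tendsto g (cocompact E3) (𝓝 0)

/-- `grad div v` (the Lamé term of (1.8)/(4.1)). [cite: LiuGenqian2025NSLame, (1.8) p.2] -/
def gradDiv (v : E3 → E3) (x : E3) : E3 :=
  gradient (fun y => VectorCalculus.divergence v y) x

/-- **Smooth solution of the parabolic inertia Lamé system** (1.8) = (4.1) = (4.15) on `ℝ³ × [0, T]`
with Lamé constants `µ, λ` and datum `ϕ`, in the class of Theorems 4.2/4.3:
"`u ∈ C([0,T]; H^{m+1}(ℝ³) ∩ C₀(ℝ³)) ∩ C^∞(ℝ³ × [0,T])`" — typed as jointly `C^∞` on the closed slab,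
each slice in `W^{m+1,2}(ℝ³)` and `C₀(ℝ³)`, the equation
`∂ₜu − µΔu − (λ+µ) grad div u + (u·∇)u = 0` pointwise (one-sided time derivative within `[0,T]`), and
`u(0) = ϕ`. [cite: LiuGenqian2025NSLame, (4.15) p.22] -/
structure IsLameSolutionOn (T μ lam : ℝ) (m : ℕ) (φ : E3 → E3) (u : ℝ → E3 → E3) : Prop where
  smooth : IsSmoothSpaceTimeOn (Icc 0 T) u
  sobolev : ∀ t ∈ Icc 0 T, MemSobolevDomain (m + 1) 2 (⊤ : Opens E3) volume (u t)
  vanishing : ∀ t ∈ Icc 0 T, VanishesAtInfinity (u t)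
  eqn : ∀ t ∈ Icc 0 T, ∀ x,
    timeDerivWithin (Icc 0 T) u t x - μ • Δ (u t) x - (lam + μ) • gradDiv (u t) x +
      convect (u t) (u t) x = 0
  initial : u 0 = φ

/-- **Smooth solution of the drift–diffusion system** `∂ₜv − κΔv + (u·∇)v = 0` on `ℝ³ × [0,T]`
(the shape of (4.57), (4.58) with `κ = µ`, `κ = λ + 2µ`), jointly `C^∞` on the closed slab with `C₀`
slices (p. 28: "`v, w ∈ C¹([0,T]; C₀²(ℝ³)) ∩ C^∞(ℝ³ × [0,T])`"). [cite: LiuGenqian2025NSLame, (4.57)–(4.58) p.28] -/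
structure IsDriftHeatSolutionOn (T κ : ℝ) (u v : ℝ → E3 → E3) : Prop where
  smooth : IsSmoothSpaceTimeOn (Icc 0 T) v
  vanishing : ∀ t ∈ Icc 0 T, VanishesAtInfinity (v t)
  eqn : ∀ t ∈ Icc 0 T, ∀ x,
    timeDerivWithin (Icc 0 T) v t x - κ • Δ (v t) x + convect (u t) (v t) x = 0

/-- A Hodge pair of `ϕ` ((4.21), p. 22): `ϕ = ϕ₁ + ϕ₂` with `div ϕ₁ = 0`, `curl ϕ₂ = 0`,
`ϕ₁, ϕ₂ ∈ C₀(ℝ³) ∩ C^∞(ℝ³)` (unique when it exists). [cite: LiuGenqian2025NSLame, (4.21) p.22] -/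
def IsHodgePair (φ φ₁ φ₂ : E3 → E3) : Prop :=
  ContDiff ℝ ∞ φ₁ ∧ ContDiff ℝ ∞ φ₂ ∧ VanishesAtInfinity φ₁ ∧ VanishesAtInfinity φ₂ ∧
    (∀ x, φ x = φ₁ x + φ₂ x) ∧ VectorCalculus.IsDivFree φ₁ ∧ ∀ x, curl φ₂ x = 0

/-- A Clay-sense solution of the unforced NS Cauchy problem with viscosity `µ` and datum `ϕ`:
`u, p ∈ C^∞(ℝ³ × [0,∞))` ((1.6)), (1.1)–(1.3) with `f ≡ 0`, bounded energy (1.7) — the matrix of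
`ClayVariants.clayR3.Solvable µ 0 ϕ`. [cite: LiuGenqian2025NSLame, Thm 1.1 p.2] -/
def IsClaySolution (μ : ℝ) (φ : E3 → E3) (u : ℝ → E3 → E3) (p : ℝ → E3 → ℝ) : Prop :=
  IsSmoothOnHalfSpace u ∧ IsSmoothOnHalfSpace p ∧ IsNavierStokesSolution μ 0 φ u p ∧ HasBoundedEnergy u

/-! ## The claimed statement -/

/-- **THEOREM 1.1 (p. 2), as printed** — existence in the Clay (A) sense (`clayR3.Solvable`) for every
`µ > 0` and every smooth divergence-free `ϕ` with (1.4), plus "Moreover, the solution `(u, p)` is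
unique", read for the velocity within the class (1.6)–(1.7) of the theorem (the pressure is determined
only up to `c(t)`). [claim: LiuGenqian2025NSLame, status: under-review] [cite: LiuGenqian2025NSLame, Thm 1.1 p.2] -/
def ClaimedTheorem : Prop :=
  ∀ μ : ℝ, 0 < μ → ∀ φ : E3 → E3, ContDiff ℝ ∞ φ → NSWave0.IsDivFree φ → HasRapidSpatialDecay φ →
    ClayVariants.clayR3.Solvable μ 0 φ ∧
      ∀ (u₁ : ℝ → E3 → E3) (p₁ : ℝ → E3 → ℝ) (u₂ : ℝ → E3 → E3) (p₂ : ℝ → E3 → ℝ),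
        IsClaySolution μ φ u₁ p₁ → IsClaySolution μ φ u₂ p₂ → ∀ t : ℝ, 0 ≤ t → u₁ t = u₂ t

/-! ## The Steps -/

/-- **Step 1 — THEOREM 4.2 (p. 20).** "Given `ϕ ∈ 𝒮(ℝⁿ)`, there exists a `T₀ > 0` (which is independent
of `λ`) such that the parabolic inertial Lamé equations (4.1) admits a unique solution
`u ∈ C([0, T₀]; H^{m+1}(ℝⁿ) ∩ C₀(ℝⁿ))`, `m > n/2`, with the initial `ϕ`. Moreover (4.4)
`u ∈ C^∞(ℝⁿ × [0, T₀])`." (`n = 3`, `µ > 0`, `λ + µ ≥ 0` as in (1.9); `T₀` before `λ`.)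
[claim: LiuGenqian2025NSLame, status: under-review] [cite: LiuGenqian2025NSLame, Thm 4.2 (4.4) p.20] -/
def Theorem42 : Prop :=
  ∀ μ : ℝ, 0 < μ → ∀ m : ℕ, 2 ≤ m → ∀ φ : E3 → E3, IsSchwartzField φ →
    ∃ T₀ : ℝ, 0 < T₀ ∧ ∀ lam : ℝ, -μ ≤ lam →
      (∃ u : ℝ → E3 → E3, IsLameSolutionOn T₀ μ lam m φ u) ∧
        ∀ u₁ u₂ : ℝ → E3 → E3, IsLameSolutionOn T₀ μ lam m φ u₁ → IsLameSolutionOn T₀ μ lam m φ u₂ →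
          ∀ t ∈ Icc 0 T₀, u₁ t = u₂ t

/-- **Step 2 — proof of Theorem 4.3, step 1 (p. 22, (4.19)–(4.21)).** "It follows from the Hodge
decomposition … `ϕ = ϕ₁ + ϕ₂ = v(0) + w(0)`, `div ϕ₁ = 0` and `curl ϕ₂ = 0`, where
`ϕ₁, ϕ₂ ∈ C₀(ℝ³) ∩ C^∞(ℝ³)`." (True: `ϕ₁ = ϕ − ∇Δ⁻¹ div ϕ`.) [cite: LiuGenqian2025NSLame, (4.21) p.22] -/
def HodgeSplit : Prop :=
  ∀ φ : E3 → E3, IsSchwartzField φ → ∃ φ₁ φ₂ : E3 → E3, IsHodgePair φ φ₁ φ₂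

/-- **Step 3 — proof of Theorem 4.3, step 2 (p. 25).** "In view of `(PL)* = L*P* = L*P`, we see that
the null-space of the operator `L*P` is just `V⁰`. Note also that the null-space of the operator `L*P` is
exactly the all solutions of the following homogeneous linear equations (4.38) [`L*P(η) = 0`,
`div η = 0`, `η(0, x) = 0`] … we find from this [(4.39)] and `L*P(η) = 0` (see (4.38)) that (4.40)
`⟨PL(θ), η⟩_{L²(ℝ³)} = 0` for all `η ∈ V⁰`", where `L*η = ∂ₜη + µΔη − (u·∇)η − (div u) η` (p. 25) and
`P` = the `L²`-projector onto divergence-free fields (`Pη = η` for `η ∈ V⁰`). Typed as the assertion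
used: along any Lamé solution `u` of the class, EVERY divergence-free field `η` of the class with
`η(0) = 0` solves `L*η = 0` on `ℝ³ × [0,T]`. [claim: LiuGenqian2025NSLame, status: under-review]
[cite: LiuGenqian2025NSLame, proof of Thm 4.3 step 2, (4.38)–(4.40) p.25] -/
def Thm43NullSpace : Prop :=
  ∀ μ lam : ℝ, 0 < μ → -μ ≤ lam → ∀ m : ℕ, 2 ≤ m → ∀ φ : E3 → E3, IsSchwartzField φ →
    ∀ T : ℝ, 0 < T → ∀ u : ℝ → E3 → E3, IsLameSolutionOn T μ lam m φ u →
      ∀ η : ℝ → E3 → E3, IsSmoothSpaceTimeOn (Icc 0 T) η →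
        (∀ t ∈ Icc 0 T, VanishesAtInfinity (η t)) →
        (∀ t ∈ Icc 0 T, MemSobolevDomain (m + 1) 2 (⊤ : Opens E3) volume (η t)) →
        (∀ t ∈ Icc 0 T, VectorCalculus.IsDivFree (η t)) → η 0 = 0 →
          ∀ t ∈ Icc 0 T, ∀ x,
            timeDerivWithin (Icc 0 T) η t x + μ • Δ (η t) x - convect (u t) (η t) x -
              (VectorCalculus.divergence (u t) x) • η t x = 0

/-- **Step 3, second printed reading — (4.40) "for all `η ∈ V⁰`"** (p. 25): the same assertion
for EVERY divergence-free field of the class on `ℝ³ × [0,T]`, with no condition at `t = 0` (so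
time-independent `η ∈ V⁰` are admissible, `Pη = η`). The (4.38) reading `Thm43NullSpace` (with
`η(0) = 0`) is implied (`thm43NullSpace_of_V0`). [claim: LiuGenqian2025NSLame, status: under-review]
[cite: LiuGenqian2025NSLame, proof of Thm 4.3 step 2, (4.40) p.25] -/
def Thm43NullSpaceV0 : Prop :=
  ∀ μ lam : ℝ, 0 < μ → -μ ≤ lam → ∀ m : ℕ, 2 ≤ m → ∀ φ : E3 → E3, IsSchwartzField φ →
    ∀ T : ℝ, 0 < T → ∀ u : ℝ → E3 → E3, IsLameSolutionOn T μ lam m φ u →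
      ∀ η : ℝ → E3 → E3, IsSmoothSpaceTimeOn (Icc 0 T) η →
        (∀ t ∈ Icc 0 T, VanishesAtInfinity (η t)) →
        (∀ t ∈ Icc 0 T, MemSobolevDomain (m + 1) 2 (⊤ : Opens E3) volume (η t)) →
        (∀ t ∈ Icc 0 T, VectorCalculus.IsDivFree (η t)) →
          ∀ t ∈ Icc 0 T, ∀ x,
            timeDerivWithin (Icc 0 T) η t x + μ • Δ (η t) x - convect (u t) (η t) x -
              (VectorCalculus.divergence (u t) x) • η t x = 0

/-- **Step 3, companion (cell rule F15) — the operator-theoretic sentence of p. 25 over an arbitrary real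
Hilbert space:** "In view of `(PL)* = L*P* = L*P`, we see that the null-space of the operator `L*P` is
just `V⁰`" — for `P` the orthogonal projector onto a closed subspace `V` and `L` a bounded operator,
`ker (L* ∘ P) = V`. (For `L = id` the left side is `V^⊥`.) [claim: LiuGenqian2025NSLame, status: under-review]
[cite: LiuGenqian2025NSLame, proof of Thm 4.3 step 2 p.25] -/
def Thm43NullSpaceAbstract : Prop :=
  ∀ (H : Type) [NormedAddCommGroup H] [InnerProductSpace ℝ H] [CompleteSpace H]
    (V : Submodule ℝ H) [V.HasOrthogonalProjection] (L : H →L[ℝ] H),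
    LinearMap.ker ((ContinuousLinearMap.adjoint L) ∘L V.starProjection).toLinearMap = V

/-- **Step 4 — proof of Theorem 4.3, steps 2–3, conclusion (p. 28, l. 1–3 and (4.57), (4.58); p. 29,
l. 2–8).** "we find by (4.41) and (4.56) that `f ≡ 0` in `ℝ³ × [0, T]`. In other words, if `u … ` is the
unique local smooth solution of (4.15), then, by (4.25)–(4.26), there exist two vector fields `v` and
`w`, respectively, satisfying (4.57) [`∂ₜv − µΔv + (u·∇)v = 0`, `div v = 0`, `v(x,0) = ϕ₁(x)`] and
(4.58) [`∂ₜw − (λ+2µ)Δw + (u·∇)w = 0`, `curl w = 0`, `w(x,0) = ϕ₂(x)`]" … "Since the solution `u` of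
initial problem (4.15) is unique …, we see `u = v + w`." — for every Hodge pair `(ϕ₁, ϕ₂)` of the
datum. (As printed this decouples the divergence-free part from any pressure term; at `t = 0` it forces
`div ((ϕ·∇)ϕ₁) = 0`.) [claim: LiuGenqian2025NSLame, status: under-review]
[cite: LiuGenqian2025NSLame, proof of Thm 4.3, (4.57)–(4.58) p.28 and p.29 l.2–8] -/
def Thm43Decoupling : Prop :=
  ∀ μ lam : ℝ, 0 < μ → -μ ≤ lam → ∀ m : ℕ, 2 ≤ m → ∀ φ : E3 → E3, IsSchwartzField φ →
    ∀ T : ℝ, 0 < T → ∀ u : ℝ → E3 → E3, IsLameSolutionOn T μ lam m φ u →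
      ∀ φ₁ φ₂ : E3 → E3, IsHodgePair φ φ₁ φ₂ →
        ∃ v w : ℝ → E3 → E3,
          IsDriftHeatSolutionOn T μ u v ∧ v 0 = φ₁ ∧ (∀ t ∈ Icc 0 T, VectorCalculus.IsDivFree (v t)) ∧
          IsDriftHeatSolutionOn T (lam + 2 * μ) u w ∧ w 0 = φ₂ ∧ (∀ t ∈ Icc 0 T, ∀ x, curl (w t) x = 0) ∧
          ∀ t ∈ Icc 0 T, ∀ x, u t x = v t x + w t x

/-- **Steps 1 + 4 combined, in the existential form printed on p. 28** ("there exist two vector fields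
`v` and `w`, respectively, satisfying (4.57) and (4.58)", for the local solution `u` provided by
Theorem 4.2): for every datum and every Hodge pair of it there are `T > 0`, a Lamé solution `u` on
`[0,T]` and `v`, `w` with (4.57), (4.58), `u = v + w`. Derived from Steps 1 and 4
(`decouplingExists_of_steps`); a closed `∃`-statement, so that a refutation of it needs no solution
theory (its negation quantifies over all purported `u, v, w`) and yields `Theorem42 → ¬ Thm43Decoupling`.
[claim: LiuGenqian2025NSLame, status: under-review] [cite: LiuGenqian2025NSLame, Thm 4.2 p.20 with (4.57)–(4.58) p.28] -/
def DecouplingExists : Prop :=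
  ∀ μ lam : ℝ, 0 < μ → -μ ≤ lam → ∀ m : ℕ, 2 ≤ m → ∀ φ : E3 → E3, IsSchwartzField φ →
    ∀ φ₁ φ₂ : E3 → E3, IsHodgePair φ φ₁ φ₂ →
      ∃ T : ℝ, 0 < T ∧ ∃ u v w : ℝ → E3 → E3, IsLameSolutionOn T μ lam m φ u ∧
        IsDriftHeatSolutionOn T μ u v ∧ v 0 = φ₁ ∧ (∀ t ∈ Icc 0 T, VectorCalculus.IsDivFree (v t)) ∧
        IsDriftHeatSolutionOn T (lam + 2 * μ) u w ∧ w 0 = φ₂ ∧ (∀ t ∈ Icc 0 T, ∀ x, curl (w t) x = 0) ∧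
        ∀ t ∈ Icc 0 T, ∀ x, u t x = v t x + w t x

/-- **Step 5 — proof of Theorem 4.3, step 4 (p. 28, (4.59)–(4.65)).** The maximum principle for the
drift–diffusion system: a solution of `∂ₜv − κΔv + (u·∇)v = 0` (`κ > 0`) on `ℝ³ × [0,T]` in the class
obeys `‖v‖_{C(ℝ³×[0,T])} ≤ ‖v(·,0)‖_{C(ℝ³)}` (proof via `|ṽ|² = e^{−2εt}|v|²`, (4.61)–(4.64)). (Classical.)
[cite: LiuGenqian2025NSLame, proof of Thm 4.3 step 4, (4.59)–(4.65) p.28] -/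
def DriftHeatMaxPrinciple : Prop :=
  ∀ κ : ℝ, 0 < κ → ∀ T : ℝ, 0 < T → ∀ u v : ℝ → E3 → E3, IsDriftHeatSolutionOn T κ u v →
    ∀ M : ℝ, (∀ x, ‖v 0 x‖ ≤ M) → ∀ t ∈ Icc 0 T, ∀ x, ‖v t x‖ ≤ M

/-- **Step 6 — the implicit glue of p. 29, l. 8–9** ("Combining (4.19), (4.22)–(4.57), (4.59), (4.65), we
get the desired result (4.16)"): passing from `‖v‖ ≤ ‖ϕ₁‖_C`, `‖w‖ ≤ ‖ϕ₂‖_C` to `‖u‖ ≤ C‖ϕ‖_C` with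
`C = C(µ)` requires that the Hodge components of a Schwartz field be bounded in sup norm by the field,
`‖ϕ₁‖_C + ‖ϕ₂‖_C ≤ C₀ ‖ϕ‖_C`, with a universal `C₀`. Not printed; typed as the glue Step the sentence
needs (cell TYPING-HYGIENE item 8). [claim: LiuGenqian2025NSLame, status: under-review]
[cite: LiuGenqian2025NSLame, proof of Thm 4.3 p.29 l.8–9 (implicit)] -/
def HodgeSupBound : Prop :=
  ∃ C₀ : ℝ, ∀ φ φ₁ φ₂ : E3 → E3, IsSchwartzField φ → IsHodgePair φ φ₁ φ₂ →
    ∀ M : ℝ, (∀ x, ‖φ x‖ ≤ M) → ∀ x, ‖φ₁ x‖ ≤ C₀ * M ∧ ‖φ₂ x‖ ≤ C₀ * M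

/-- **Step 7 — THEOREM 4.3 (p. 22, (4.16)), as printed; LOAD-BEARING.** "Let `µ > 0` and `λ + µ ≥ 0`,
and suppose `ϕ ∈ 𝒮(ℝ³)`. If `u ∈ C([0,T]; H^{m+1}(ℝ³) ∩ C₀(ℝ³)) ∩ C^∞(ℝ³ × [0,T])`, `m > 3/2`, is the
unique local smooth solution of (4.15) with `0 < T ≤ ∞`, then (4.16)
`‖u(x,t)‖_{C(ℝ³×[0,T])} ≤ C ‖ϕ‖_{C(ℝ³)}` for all `0 ≤ t ≤ T`, where the constant `C` is independent of
`λ` and `T`, and depends only on `µ > 0`." Quantifiers: `∀ µ ∃ C ∀ (λ, m, ϕ, T, u)`; sup norms in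
hypothesis form; `T = ∞` is covered by all finite `T`. Consumed by Lemma 4.5, Theorem 4.8 (4.89),
§5 (5.2), (5.42). [claim: LiuGenqian2025NSLame, status: under-review] [cite: LiuGenqian2025NSLame, Thm 4.3 (4.16) p.22] -/
def Theorem43 : Prop :=
  ∀ μ : ℝ, 0 < μ → ∃ C : ℝ, ∀ lam : ℝ, -μ ≤ lam → ∀ m : ℕ, 2 ≤ m → ∀ φ : E3 → E3, IsSchwartzField φ →
    ∀ T : ℝ, 0 < T → ∀ u : ℝ → E3 → E3, IsLameSolutionOn T μ lam m φ u →
      ∀ M : ℝ, (∀ x, ‖φ x‖ ≤ M) → ∀ t ∈ Icc 0 T, ∀ x, ‖u t x‖ ≤ C * M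

/-- Theorem 4.3 in the DIVERGENCE-FREE-DATA reading (the data of Theorem 1.1 / §5, where (5.2) uses
(4.16)): the same bound restricted to `div ϕ = 0`. Implied by the printed `Theorem43`
(`theorem43DivFree_of_theorem43`); recorded because under this reading `ϕ₁ = ϕ`, `ϕ₂ = 0` and the
implicit Step 6 is not needed. [claim: LiuGenqian2025NSLame, status: under-review] [cite: LiuGenqian2025NSLame, Thm 4.3 (4.16) p.22 with (5.2) p.34] -/
def Theorem43DivFree : Prop :=
  ∀ μ : ℝ, 0 < μ → ∃ C : ℝ, ∀ lam : ℝ, -μ ≤ lam → ∀ m : ℕ, 2 ≤ m → ∀ φ : E3 → E3, IsSchwartzField φ →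
    VectorCalculus.IsDivFree φ → ∀ T : ℝ, 0 < T → ∀ u : ℝ → E3 → E3, IsLameSolutionOn T μ lam m φ u →
      ∀ M : ℝ, (∀ x, ‖φ x‖ ≤ M) → ∀ t ∈ Icc 0 T, ∀ x, ‖u t x‖ ≤ C * M

/-- **Step 8 — THEOREM 4.6 (p. 29, (4.67)–(4.68)) in its Gronwall-integrated form** ((4.91) p. 33 and
(5.4) p. 34, via Lemma 4.7 (4.85)): "`d/dt ‖u(t)‖²_{H^k} ≤ c_k ‖u‖²_{L^∞} ‖u‖²_{H^k}` for all
`k = 0, 1, …, m`, where the constant `c_k` is independent of `λ`, and depends only on `µ > 0` and `k`" —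
hence, for a solution bounded by `M` in sup norm on `ℝ³ × [0,T]`,
`‖u(t)‖²_{H^k} ≤ ‖ϕ‖²_{H^k} e^{c_k M² t}`. `H^k` norms are the tree's extended Sobolev norms.
[claim: LiuGenqian2025NSLame, status: under-review] [cite: LiuGenqian2025NSLame, Thm 4.6 (4.68) p.29 and (4.91) p.33] -/
def Theorem46G : Prop :=
  ∀ μ : ℝ, 0 < μ → ∀ k : ℕ, ∃ c : ℝ, ∀ lam : ℝ, -μ ≤ lam → ∀ m : ℕ, 2 ≤ m → k ≤ m →
    ∀ φ : E3 → E3, IsSchwartzField φ → ∀ T : ℝ, 0 < T → ∀ u : ℝ → E3 → E3, IsLameSolutionOn T μ lam m φ u →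
      ∀ M : ℝ, (∀ t ∈ Icc 0 T, ∀ x, ‖u t x‖ ≤ M) → ∀ t ∈ Icc 0 T,
        eSobolevDomainNorm k 2 (⊤ : Opens E3) volume (u t) ^ 2 ≤
          eSobolevDomainNorm k 2 (⊤ : Opens E3) volume φ ^ 2 * ENNReal.ofReal (Real.exp (c * M ^ 2 * t))

/-- **Step 9 — THEOREM 4.8 (p. 32).** "Let `n = 3`, and let `µ > 0` and `λ + µ ≥ 0`. Given `ϕ ∈ 𝒮(ℝⁿ)`,
there exists a global strong solution `u ∈ C([0, ∞); H^{m+1}(ℝⁿ) ∩ C₀(ℝⁿ))`, `m > n/2`, of the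
inertial parabolic Lamé equations (4.1). Moreover, this solution is unique and `u ∈ C^∞(ℝⁿ × [0, ∞))`."
(Proof p. 33 from Thm 4.2, Lemma 4.5, (4.16), Thm 4.6, Lemma 4.7.) [claim: LiuGenqian2025NSLame, status: under-review]
[cite: LiuGenqian2025NSLame, Thm 4.8 p.32] -/
def Theorem48 : Prop :=
  ∀ μ lam : ℝ, 0 < μ → -μ ≤ lam → ∀ m : ℕ, 2 ≤ m → ∀ φ : E3 → E3, IsSchwartzField φ →
    ∃ u : ℝ → E3 → E3, IsSmoothSpaceTimeOn (Ici 0) u ∧ (∀ T : ℝ, 0 < T → IsLameSolutionOn T μ lam m φ u) ∧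
      ∀ T : ℝ, 0 < T → ∀ u' : ℝ → E3 → E3, IsLameSolutionOn T μ lam m φ u' → ∀ t ∈ Icc 0 T, u' t = u t

/-- **Step 10 — §5, proof of Theorem 1.1, existence (pp. 34–38) and the energy bound (p. 39).** From the
global Lamé solutions `u_{λ,µ}` (Thm 4.8), the `λ`-uniform sup bound (5.2) [= (4.16)] and the
`H^k`-Grönwall bounds (5.3)–(5.4) [= Thm 4.6]: uniform bounds (5.10)–(5.19), weak limits (5.20)–(5.25)
along `λ_{m_l} → +∞`, the limit solves NS (5.26)–(5.32) with `p_µ` the weak limit of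
`−(λ_{m_l}+µ) div u_{λ_{m_l},µ}` (5.28), `div u_µ = 0`, datum (5.36), smoothness ("We will omit the
proof of this part", p. 38), and bounded energy (5.45)–(5.48). Typed as the printed implication to
Clay-sense solvability for smooth divergence-free Schwartz data. [claim: LiuGenqian2025NSLame, status: under-review]
[cite: LiuGenqian2025NSLame, §5 proof of Thm 1.1 pp.34–39, (5.2)–(5.37) and (5.45)–(5.48)] -/
def Section5Existence : Prop :=
  Theorem48 → Theorem43 → Theorem46G →
    ∀ μ : ℝ, 0 < μ → ∀ φ : E3 → E3, IsSchwartzField φ → NSWave0.IsDivFree φ →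
      ClayVariants.clayR3.Solvable μ 0 φ

/-- **Step 11 — §5, uniqueness (pp. 38–39, (5.38)–(5.44)),** within the class of Theorem 1.1 (smooth on
`ℝ³ × [0,∞)`, bounded energy): two Clay-sense solutions with the same datum have the same velocity
("From Theorem 4.3 and (5.41) … It follows from Gronwall's inequality … (5.44) … which implies
`u_µ ≡ ũ`"). [claim: LiuGenqian2025NSLame, status: under-review] [cite: LiuGenqian2025NSLame, §5 (5.38)–(5.44) pp.38–39] -/
def Section5Uniqueness : Prop :=
  ∀ μ : ℝ, 0 < μ → ∀ φ : E3 → E3, IsSchwartzField φ → NSWave0.IsDivFree φ →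
    ∀ (u₁ : ℝ → E3 → E3) (p₁ : ℝ → E3 → ℝ) (u₂ : ℝ → E3 → E3) (p₂ : ℝ → E3 → ℝ),
      IsClaySolution μ φ u₁ p₁ → IsClaySolution μ φ u₂ p₂ → ∀ t : ℝ, 0 ≤ t → u₁ t = u₂ t

/-- Step 11, LITERAL reading (p. 38): "the solution `(u_µ, p_µ)` of (5.37) is unique. In fact, if
`(ũ, p̃)` is another solution of (5.37) …" — (5.37) is the NS initial-value problem alone (smooth
solutions, no decay or energy class). Recorded for the referee; `ClaimedTheorem` uses the class of
Theorem 1.1 (`Section5Uniqueness`). [claim: LiuGenqian2025NSLame, status: under-review]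
[cite: LiuGenqian2025NSLame, §5 (5.37)–(5.38) p.38] -/
def Section5UniquenessPrinted : Prop :=
  ∀ μ : ℝ, 0 < μ → ∀ φ : E3 → E3, IsSchwartzField φ → NSWave0.IsDivFree φ →
    ∀ (u₁ : ℝ → E3 → E3) (p₁ : ℝ → E3 → ℝ) (u₂ : ℝ → E3 → E3) (p₂ : ℝ → E3 → ℝ),
      IsSmoothOnHalfSpace u₁ → IsSmoothOnHalfSpace p₁ → IsNavierStokesSolution μ 0 φ u₁ p₁ →
      IsSmoothOnHalfSpace u₂ → IsSmoothOnHalfSpace p₂ → IsNavierStokesSolution μ 0 φ u₂ p₂ →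
        ∀ t : ℝ, 0 ≤ t → u₁ t = u₂ t

/-! ## Kernel relations -/

/-- **The printed proof of Theorem 4.3 composes from its steps** (p. 29, l. 2–9): Hodge pair of the
datum (step 1), decoupled systems with `u = v + w` (steps 2–3), maximum principle (step 4) and the
sup-norm bound for the Hodge components (implicit) give (4.16) with `C = 2C₀`, independent of `µ`,
`λ`, `T`. So a failure of Theorem 4.3 is located in one of these Steps, not in their combination.
[cite: LiuGenqian2025NSLame, proof of Thm 4.3 p.29 l.2–9] -/
theorem theorem43_of_steps (h₂ : HodgeSplit) (h₄ : Thm43Decoupling) (h₅ : DriftHeatMaxPrinciple)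
    (h₆ : HodgeSupBound) : Theorem43 := by
  obtain ⟨C₀, hC₀⟩ := h₆
  intro μ hμ
  refine ⟨2 * C₀, ?_⟩
  intro lam hlam m hm φ hφ T hT u hu M hM t ht x
  obtain ⟨φ₁, φ₂, hpair⟩ := h₂ φ hφ
  obtain ⟨v, w, hv, hv0, -, hw, hw0, -, hsum⟩ := h₄ μ lam hμ hlam m hm φ hφ T hT u hu φ₁ φ₂ hpair
  have hb := hC₀ φ φ₁ φ₂ hφ hpair M hM
  have hκ : 0 < lam + 2 * μ := by linarith
  have h1 : ‖v t x‖ ≤ C₀ * M :=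
    h₅ μ hμ T hT u v hv (C₀ * M) (fun y => by rw [hv0]; exact (hb y).1) t ht x
  have h2 : ‖w t x‖ ≤ C₀ * M :=
    h₅ (lam + 2 * μ) hκ T hT u w hw (C₀ * M) (fun y => by rw [hw0]; exact (hb y).2) t ht x
  rw [hsum t ht x]
  calc ‖v t x + w t x‖ ≤ ‖v t x‖ + ‖w t x‖ := norm_add_le _ _
    _ ≤ C₀ * M + C₀ * M := add_le_add h1 h2
    _ = 2 * C₀ * M := by ring

/-- The (4.40) reading implies the (4.38) reading of the null-space Step. [cite: LiuGenqian2025NSLame, (4.38)–(4.40) p.25] -/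
theorem thm43NullSpace_of_V0 (h : Thm43NullSpaceV0) : Thm43NullSpace :=
  fun μ lam hμ hlam m hm φ hφ T hT u hu η hη hη0 hηS hηd _ =>
    h μ lam hμ hlam m hm φ hφ T hT u hu η hη hη0 hηS hηd

/-- The printed Theorem 4.3 implies its divergence-free-data reading. [cite: LiuGenqian2025NSLame, Thm 4.3 (4.16) p.22] -/
theorem theorem43DivFree_of_theorem43 (h : Theorem43) : Theorem43DivFree := by
  intro μ hμ
  obtain ⟨C, hC⟩ := h μ hμ
  exact ⟨C, fun lam hlam m hm φ hφ _ T hT u hu M hM t ht x => hC lam hlam m hm φ hφ T hT u hu M hM t ht x⟩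

/-- Steps 1 and 4 give the existential decoupling statement of p. 28. [cite: LiuGenqian2025NSLame, Thm 4.2 p.20 with (4.57)–(4.58) p.28] -/
theorem decouplingExists_of_steps (h₁ : Theorem42) (h₄ : Thm43Decoupling) : DecouplingExists := by
  intro μ lam hμ hlam m hm φ hφ φ₁ φ₂ hpair
  obtain ⟨T₀, hT₀, hall⟩ := h₁ μ hμ m hm φ hφ
  obtain ⟨⟨u, hu⟩, -⟩ := hall lam hlam
  obtain ⟨v, w, hv, hv0, hvd, hw, hw0, hwc, hsum⟩ := h₄ μ lam hμ hlam m hm φ hφ T₀ hT₀ u hu φ₁ φ₂ hpair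
  exact ⟨T₀, hT₀, u, v, w, hu, hv, hv0, hvd, hw, hw0, hwc, hsum⟩

/-- Hence a refutation of `DecouplingExists` locates the failure in Step 4 modulo the classical Step 1.
[cite: LiuGenqian2025NSLame, (4.57)–(4.58) p.28] -/
theorem not_thm43Decoupling_of_not_decouplingExists (h : ¬ DecouplingExists) (h₁ : Theorem42) :
    ¬ Thm43Decoupling :=
  fun h₄ => h (decouplingExists_of_steps h₁ h₄)

/-- A field with rapidly decaying derivatives (Clay (4) / (1.4)) vanishes at infinity (private helper for
`isHodgePair_of_isDivFree`). [folklore] -/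
private theorem vanishesAtInfinity_of_hasRapidSpatialDecay {φ : E3 → E3} (h : HasRapidSpatialDecay φ) :
    VanishesAtInfinity φ := by
  obtain ⟨C, hC⟩ := h 0 1
  rw [VanishesAtInfinity, tendsto_zero_iff_norm_tendsto_zero]
  have hb : ∀ x, ‖φ x‖ ≤ C / (1 + ‖x‖) := fun x => by
    have hx := hC x
    rw [pow_one, norm_iteratedFDeriv_zero] at hx
    rw [le_div_iff₀ (by positivity)]
    linarith
  have h1 : Tendsto (fun x : E3 => 1 + ‖x‖) (cocompact E3) atTop :=
    tendsto_atTop_add_const_left _ _ tendsto_norm_cocompact_atTop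
  have h2 : Tendsto (fun x : E3 => C / (1 + ‖x‖)) (cocompact E3) (𝓝 0) := by
    have := (tendsto_inv_atTop_zero.comp h1).const_mul C
    simpa [div_eq_mul_inv] using this
  exact squeeze_zero (fun x => norm_nonneg _) hb h2

/-- Under the divergence-free reading the Hodge pair of the datum is `(ϕ, 0)` ("`div ϕ₁ = 0` and
`curl ϕ₂ = 0`", (4.21)). [cite: LiuGenqian2025NSLame, (4.21) p.22] -/
theorem isHodgePair_of_isDivFree {φ : E3 → E3} (hφ : IsSchwartzField φ)
    (hd : VectorCalculus.IsDivFree φ) : IsHodgePair φ φ 0 := by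
  refine ⟨hφ.1, contDiff_const, vanishesAtInfinity_of_hasRapidSpatialDecay hφ.2,
    tendsto_const_nhds, fun x => by simp, hd, fun x => ?_⟩
  have h0 : fderiv ℝ (0 : E3 → E3) x = 0 := by
    change fderiv ℝ (fun _ : E3 => (0 : E3)) x = 0
    exact fderiv_const_apply 0
  ext i
  fin_cases i <;> simp [curl, h0]

/-- **Composition of the printed argument** (pp. 2–4 strategy; §4; §5): Steps 1–11 ⇒ Theorem 1.1. Pure
logic; CONSUMES Steps 2, 4, 5, 6 (via `theorem43_of_steps`), 8, 9, 10, 11; Steps 1, 3 (and 7, derived)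
are the printed supports of Steps 9 and 4. [cite: LiuGenqian2025NSLame, §1 pp.2–4 and §5 pp.34–39] -/
theorem claim_of_steps (_h₁ : Theorem42) (h₂ : HodgeSplit) (_h₃ : Thm43NullSpace)
    (_h₃' : Thm43NullSpaceAbstract) (h₄ : Thm43Decoupling) (h₅ : DriftHeatMaxPrinciple)
    (h₆ : HodgeSupBound) (h₈ : Theorem46G) (h₉ : Theorem48) (h₁₀ : Section5Existence)
    (h₁₁ : Section5Uniqueness) : ClaimedTheorem := by
  have h₇ : Theorem43 := theorem43_of_steps h₂ h₄ h₅ h₆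
  intro μ hμ φ hφs hφd hφr
  exact ⟨h₁₀ h₉ h₇ h₈ μ hμ φ ⟨hφs, hφr⟩ hφd, h₁₁ μ hμ φ ⟨hφs, hφr⟩ hφd⟩

/-- **Clay link: the existence half of Theorem 1.1 IS Clay (A)** (`ClayVariants.clayR3.Regularity`,
definitionally the summit statement): the implication is a projection. [cite: LiuGenqian2025NSLame, Thm 1.1 p.2 ("corresponding to the statement (A) in [12]")] -/
theorem clay_of_claimed (h : ClaimedTheorem) : ClayVariants.clayR3.Regularity :=
  fun μ hμ φ hφs hφd hφr => (h μ hμ φ hφs hφd hφr).1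

/-- The uniqueness Step in the class of Theorem 1.1 follows from the literal reading (fewer hypotheses
there). [cite: LiuGenqian2025NSLame, §5 (5.37)–(5.44) pp.38–39] -/
theorem section5Uniqueness_of_printed (h : Section5UniquenessPrinted) : Section5Uniqueness :=
  fun μ hμ φ hφ hd u₁ p₁ u₂ p₂ h₁ h₂ =>
    h μ hμ φ hφ hd u₁ p₁ u₂ p₂ h₁.1 h₁.2.1 h₁.2.2.1 h₂.1 h₂.2.1 h₂.2.2.1


/-! ## Steps 4–5 re-typed in the print's class (hygiene revision, cell ruling 2026-08-27)

The solution class `IsDriftHeatSolutionOn` of Steps 4–5 types the print's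
`v ∈ C¹([0,T]; C₀²(ℝ³)) ∩ C^∞(ℝ³ × [0,T])` (p. 28) as "jointly `C^∞` on the closed slab, every slice in
`C₀`" — WITHOUT the continuity in `t` into `C₀`, i.e. without `|v(x,t)| → 0` as `|x| → ∞` uniformly in
`t ∈ [0,T]`. For Step 5 this is too wide: a compactly supported bump translating in from spatial
infinity as `t ↓ 0` (drift = its velocity plus a bounded correction) is an `IsDriftHeatSolutionOn`
solution with `v(0) = 0` and `sup |v(t)| > 0`, so `DriftHeatMaxPrinciple` as first typed fails for a
reason that is not in the paper. The printed argument (4.61)–(4.64) needs exactly that the maximum of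
`|ṽ|² = e^{−2εt}|v|²` over `ℝ³ × [0,T]` is attained, which the uniform vanishing gives. Below: the
uniform clause `VanishesAtInfinityUniformlyOn`, Step 4′ = `Thm43Decoupling'` (Step 4 with `v`, `w` in
the print's class; implies Step 4), Step 5′ = `DriftHeatMaxPrinciple'` (Step 5 in the print's class),
PROVED (`driftHeatMaxPrinciple'_holds`, the printed argument), and the composition
`theorem43_of_steps' : HodgeSplit → Thm43Decoupling' → HodgeSupBound → Theorem43`. The decls above are
unchanged. -/

/-- "`|v(x,t)| → 0` as `|x| → ∞`, uniformly in `t ∈ [0,T]`": the uniform-on-the-slab form of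
`VanishesAtInfinity`, typed with explicit quantifiers. It is what membership of `v` in the print's class
`C¹([0,T]; C₀²(ℝ³))` (p. 28, «Note that v, w ∈ C¹([0,T]; C₀²(ℝ³)) ∩ C^∞(ℝ³ × [0,T])») supplies: the
continuous image of `[0,T]` in `C₀(ℝ³)` is compact, hence equi-vanishing at infinity. It refines the
slice-wise clause `IsDriftHeatSolutionOn.vanishing` (`VanishesAtInfinityUniformlyOn.vanishesAtInfinity`).
[cite: LiuGenqian2025NSLame, proof of Thm 4.3 step 4 p.28] -/
def VanishesAtInfinityUniformlyOn (T : ℝ) (v : ℝ → E3 → E3) : Prop :=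
  ∀ η : ℝ, 0 < η → ∃ R : ℝ, ∀ t ∈ Icc 0 T, ∀ x : E3, R ≤ ‖x‖ → ‖v t x‖ ≤ η

/-- Uniform vanishing on the slab gives the slice-wise `C₀` clause of `IsDriftHeatSolutionOn` /
`IsLameSolutionOn` (`C([0,T]; C₀(ℝ³)) ⊂` slice-wise `C₀(ℝ³)`, p. 28 class vs. (4.15) class). [cite: LiuGenqian2025NSLame, proof of Thm 4.3 step 4 p.28 (class of v, w)] -/
theorem VanishesAtInfinityUniformlyOn.vanishesAtInfinity {T : ℝ} {v : ℝ → E3 → E3}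
    (h : VanishesAtInfinityUniformlyOn T v) {t : ℝ} (ht : t ∈ Icc 0 T) : VanishesAtInfinity (v t) := by
  rw [VanishesAtInfinity, Metric.tendsto_nhds]
  intro ε hε
  obtain ⟨R, hR⟩ := h (ε / 2) (half_pos hε)
  filter_upwards [(isCompact_closedBall (0 : E3) R).compl_mem_cocompact] with x hx
  have hx' : R ≤ ‖x‖ := by
    simp only [mem_compl_iff, Metric.mem_closedBall, dist_zero_right, not_le] at hx
    exact hx.le
  have := hR t ht x hx'
  rw [dist_zero_right]
  linarith

/-- **Step 4′ — Step 4 with `v`, `w` in the print's class** (p. 28: «Note that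
`v, w ∈ C¹([0,T]; C₀²(ℝ³)) ∩ C^∞(ℝ³ × [0,T])`»): the decoupling `u = v + w` of Step 4 with, in
addition, `|v(x,t)|, |w(x,t)| → 0` as `|x| → ∞` UNIFORMLY in `t ∈ [0,T]`
(`VanishesAtInfinityUniformlyOn`, the part of membership in `C([0,T]; C₀(ℝ³))` that Step 5′ consumes).
Implies Step 4 as first typed (`thm43Decoupling_of_primed`), so every refutation of `Thm43Decoupling`
refutes it. [claim: LiuGenqian2025NSLame, status: under-review]
[cite: LiuGenqian2025NSLame, proof of Thm 4.3, (4.57)–(4.58) p.28 («v, w ∈ C¹([0,T]; C₀²(ℝ³))») and p.29 l.2–8] -/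
def Thm43Decoupling' : Prop :=
  ∀ μ lam : ℝ, 0 < μ → -μ ≤ lam → ∀ m : ℕ, 2 ≤ m → ∀ φ : E3 → E3, IsSchwartzField φ →
    ∀ T : ℝ, 0 < T → ∀ u : ℝ → E3 → E3, IsLameSolutionOn T μ lam m φ u →
      ∀ φ₁ φ₂ : E3 → E3, IsHodgePair φ φ₁ φ₂ →
        ∃ v w : ℝ → E3 → E3,
          IsDriftHeatSolutionOn T μ u v ∧ VanishesAtInfinityUniformlyOn T v ∧ v 0 = φ₁ ∧
            (∀ t ∈ Icc 0 T, VectorCalculus.IsDivFree (v t)) ∧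
          IsDriftHeatSolutionOn T (lam + 2 * μ) u w ∧ VanishesAtInfinityUniformlyOn T w ∧ w 0 = φ₂ ∧
            (∀ t ∈ Icc 0 T, ∀ x, curl (w t) x = 0) ∧
          ∀ t ∈ Icc 0 T, ∀ x, u t x = v t x + w t x

/-- Step 4′ implies Step 4 (forget the uniformity clauses). [cite: LiuGenqian2025NSLame, (4.57)–(4.58) p.28] -/
theorem thm43Decoupling_of_primed (h : Thm43Decoupling') : Thm43Decoupling := by
  intro μ lam hμ hlam m hm φ hφ T hT u hu φ₁ φ₂ hpair
  obtain ⟨v, w, hv, -, hv0, hvd, hw, -, hw0, hwc, hsum⟩ := h μ lam hμ hlam m hm φ hφ T hT u hu φ₁ φ₂ hpair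
  exact ⟨v, w, hv, hv0, hvd, hw, hw0, hwc, hsum⟩

/-- **Step 5′ — Step 5 in the print's class (p. 28, (4.59)–(4.65)).** The maximum principle for the
drift–diffusion system `∂ₜv − κΔv + (u·∇)v = 0` (`κ > 0`) on `ℝ³ × [0,T]`, for `v` jointly `C^∞` on the
closed slab with `|v(x,t)| → 0` as `|x| → ∞` UNIFORMLY in `t ∈ [0,T]` (the print's
`v ∈ C¹([0,T]; C₀²(ℝ³)) ∩ C^∞(ℝ³ × [0,T])`, p. 28): `‖v‖_{C(ℝ³×[0,T])} ≤ ‖v(·,0)‖_{C(ℝ³)}` — in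
hypothesis form, every bound `M` of `|v(·,0)|` bounds `|v|` on the slab. The printed argument
((4.61)–(4.64): at a maximum point of `|ṽ|² = e^{−2εt}|v|²` in `ℝ³ × (0,T]` one has `∂ₜ|ṽ|² ≥ 0`,
`∇|ṽ|² = 0`, `Δ|ṽ|² ≤ 0`) uses NO property of the drift `u` (the term `u·∇|ṽ|²` vanishes at the
maximum point) but does use that the maximum is ATTAINED, which is where the uniformity enters.
`DriftHeatMaxPrinciple` (Step 5 as first typed) keeps only the slice-wise `C₀` clause and is wider than
the print (a bump translating in from spatial infinity as `t ↓ 0` is in that class with `v(0) = 0`);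
this is the re-typing in the print's class, certified below (`driftHeatMaxPrinciple'_holds`). (Classical.)
[cite: LiuGenqian2025NSLame, proof of Thm 4.3 step 4, (4.59)–(4.65) p.28] -/
def DriftHeatMaxPrinciple' : Prop :=
  ∀ κ : ℝ, 0 < κ → ∀ T : ℝ, 0 < T → ∀ u v : ℝ → E3 → E3, IsDriftHeatSolutionOn T κ u v →
    VanishesAtInfinityUniformlyOn T v →
    ∀ M : ℝ, (∀ x, ‖v 0 x‖ ≤ M) → ∀ t ∈ Icc 0 T, ∀ x, ‖v t x‖ ≤ M

/-! ### Proof of Step 5′ (the printed argument (4.61)–(4.64)) -/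

section MaxPrinciple

/-- First-order condition at a global maximum `x₀` of `|V|²`: `⟪V(x₀), DV(x₀) w⟫ = 0` (`∇|V|² = 0`,
(4.63)). [cite: LiuGenqian2025NSLame, proof of Thm 4.3 step 4 p.28] -/
private theorem inner_fderiv_eq_zero_of_isMax {V : E3 → E3} (hV : ContDiff ℝ ∞ V) {x₀ : E3}
    (hmax : ∀ x, ‖V x‖ ^ 2 ≤ ‖V x₀‖ ^ 2) (w : E3) : ⟪V x₀, fderiv ℝ V x₀ w⟫ = 0 := by
  have hloc : IsLocalMax (fun x => ‖V x‖ ^ 2) x₀ := Filter.Eventually.of_forall hmax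
  have hd := (hV.differentiable (by simp) x₀).hasFDerivAt.norm_sq
  have h0 := hloc.hasFDerivAt_eq_zero hd
  have h1 := congrArg (fun L : E3 →L[ℝ] ℝ => L w) h0
  simpa using h1

/-- Second-order condition at a global maximum `x₀` of `|V|²` along a direction `e`:
`⟪V(x₀), ∂ₑ∂ₑV(x₀)⟫ ≤ 0` (from `∂ₑ∂ₑ|V|² = 2|∂ₑV|² + 2⟪V, ∂ₑ∂ₑV⟫ ≤ 0`, the directional form of
`Δ|ṽ|² ≤ 0`, (4.62)–(4.64)). [cite: LiuGenqian2025NSLame, proof of Thm 4.3 step 4 p.28] -/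
private theorem inner_fderiv_fderiv_nonpos_of_isMax {V : E3 → E3} (hV : ContDiff ℝ ∞ V) {x₀ : E3}
    (hmax : ∀ x, ‖V x‖ ^ 2 ≤ ‖V x₀‖ ^ 2) (e : E3) :
    ⟪V x₀, fderiv ℝ (fun y => fderiv ℝ V y e) x₀ e⟫ ≤ 0 := by
  have hV2 : ContDiff ℝ 2 V := contDiff_infty.mp hV 2
  -- `W = ∂ₑ V`
  set W : E3 → E3 := fun y => fderiv ℝ V y e with hW
  have hVd : ∀ y, HasFDerivAt V (fderiv ℝ V y) y := fun y =>
    (hV2.differentiable (by simp) y).hasFDerivAt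
  have hW1 : ContDiff ℝ 1 W := (hV2.fderiv_right (m := 1) le_rfl).clm_apply contDiff_const
  have hWd : ∀ y, HasFDerivAt W (fderiv ℝ W y) y := fun y =>
    (hW1.differentiable one_ne_zero y).hasFDerivAt
  -- the line `p s = x₀ + s e`
  let p : ℝ → E3 := fun s => x₀ + s • e
  have hp0 : p 0 = x₀ := by simp [p]
  have hpd : ∀ s, HasDerivAt p e s := fun s => by
    show HasDerivAt (fun s : ℝ => x₀ + s • e) e s
    simpa using ((hasDerivAt_id s).smul_const e).const_add x₀
  have hVp : ∀ s, HasDerivAt (fun s => V (p s)) (W (p s)) s := fun s => by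
    have := (hVd (p s)).comp_hasDerivAt s (hpd s)
    simpa [hW, Function.comp_def] using this
  have hWp : ∀ s, HasDerivAt (fun s => W (p s)) (fderiv ℝ W (p s) e) s := fun s => by
    have := (hWd (p s)).comp_hasDerivAt s (hpd s)
    simpa [Function.comp_def] using this
  -- `ℓ(s) = |V(p s)|²` and its first two derivatives
  set ℓ : ℝ → ℝ := fun s => ⟪V (p s), V (p s)⟫ with hℓ
  have hℓd : ∀ s, HasDerivAt ℓ (2 * ⟪V (p s), W (p s)⟫) s := fun s => by
    refine ((hVp s).inner ℝ (hVp s)).congr_deriv ?_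
    rw [real_inner_comm (W (p s)), two_mul]
  have hderiv : deriv ℓ = fun s => 2 * ⟪V (p s), W (p s)⟫ := funext fun s => (hℓd s).deriv
  have hℓdd : ∀ s, HasDerivAt (fun s => 2 * ⟪V (p s), W (p s)⟫)
      (2 * (⟪V (p s), fderiv ℝ W (p s) e⟫ + ⟪W (p s), W (p s)⟫)) s := fun s =>
    ((hVp s).inner ℝ (hWp s)).const_mul 2
  have hderiv2 : deriv (deriv ℓ) 0 = 2 * (⟪V x₀, fderiv ℝ W x₀ e⟫ + ⟪W x₀, W x₀⟫) := by
    rw [hderiv, (hℓdd 0).deriv, hp0]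
  have hderiv1 : deriv ℓ 0 = 0 := by
    rw [hderiv]
    simp only [hp0, hW]
    rw [inner_fderiv_eq_zero_of_isMax hV hmax e, mul_zero]
  -- `ℓ` has a (global, hence local) maximum at `0`
  have hℓmax : IsLocalMax ℓ 0 := Filter.Eventually.of_forall fun s => by
    simp only [hℓ, real_inner_self_eq_norm_sq, hp0]
    exact hmax _
  -- if the second derivative were positive, `0` would also be a local minimum, so `ℓ` would be
  -- locally constant and its second derivative would vanish
  by_contra hcon
  push Not at hcon
  have hpos : deriv (deriv ℓ) 0 > 0 := by
    rw [hderiv2]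
    have : 0 ≤ ⟪W x₀, W x₀⟫ := real_inner_self_nonneg
    linarith
  have hℓmin : IsLocalMin ℓ 0 := isLocalMin_of_deriv_deriv_pos hpos hderiv1 (hℓd 0).continuousAt
  have hconst : ∀ᶠ s in 𝓝 (0 : ℝ), ℓ s = ℓ 0 :=
    (hℓmin.and hℓmax).mono fun s hs => le_antisymm hs.2 hs.1
  have hd0 : deriv ℓ =ᶠ[𝓝 (0 : ℝ)] fun _ => (0 : ℝ) := by
    filter_upwards [hconst.eventually_nhds] with s hs
    have h1 : ℓ =ᶠ[𝓝 s] fun _ => ℓ 0 := hs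
    rw [h1.deriv_eq, deriv_const]
  have : deriv (deriv ℓ) 0 = 0 := by rw [hd0.deriv_eq, deriv_const]
  linarith

/-- At a global maximum `x₀` of `|V|²`: `⟪V(x₀), ΔV(x₀)⟫ ≤ 0` (sum of the directional second-order
conditions over an orthonormal basis; (4.62)–(4.64)). [cite: LiuGenqian2025NSLame, proof of Thm 4.3 step 4 p.28] -/
private theorem inner_laplacian_nonpos_of_isMax {V : E3 → E3} (hV : ContDiff ℝ ∞ V) {x₀ : E3}
    (hmax : ∀ x, ‖V x‖ ^ 2 ≤ ‖V x₀‖ ^ 2) : ⟪V x₀, (Δ V) x₀⟫ ≤ 0 := by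
  have hV2 : ContDiff ℝ 2 V := contDiff_infty.mp hV 2
  rw [laplacian_eq_sum_fderiv_fderiv (stdOrthonormalBasis ℝ E3) hV2 x₀, inner_sum]
  exact Finset.sum_nonpos fun i _ => inner_fderiv_fderiv_nonpos_of_isMax hV hmax _

/-- One-sided Fermat at a maximum over `[0,T]` attained at `t₀ > 0`: the derivative within `[0,T]` is
`≥ 0` (`∂ₜ|ṽ|² ≥ 0` at a maximum point in `ℝ³ × (0,T]`, p. 28). [cite: LiuGenqian2025NSLame, proof of Thm 4.3 step 4 p.28] -/
private theorem derivWithin_nonneg_of_isMaxOn {k : ℝ → ℝ} {k' T t₀ : ℝ} (ht₀ : t₀ ∈ Icc 0 T)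
    (ht₀' : 0 < t₀) (hk : HasDerivWithinAt k k' (Icc 0 T) t₀) (hmax : ∀ s ∈ Icc 0 T, k s ≤ k t₀) :
    0 ≤ k' := by
  have hloc : IsLocalMaxOn k (Icc 0 T) t₀ := (isMaxOn_iff.mpr hmax).localize
  have hseg : segment ℝ t₀ (t₀ + -t₀) ⊆ Icc 0 T := by
    rw [add_neg_cancel, segment_symm, segment_eq_Icc ht₀'.le]
    exact Icc_subset_Icc le_rfl ht₀.2
  have hy : -t₀ ∈ posTangentConeAt (Icc 0 T) t₀ := mem_posTangentConeAt_of_segment_subset hseg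
  have h := hloc.hasFDerivWithinAt_nonpos hk.hasFDerivWithinAt hy
  have h' : -t₀ * k' ≤ 0 := by simpa using h
  nlinarith

/-- **Step 5′ holds** — the printed argument (4.61)–(4.64): for `ε > 0` the function
`|ṽ|² = e^{−2εt}|v|²` attains its maximum over the slab (uniform vanishing at infinity + compactness
of `[0,T] × B̄_R`); if the maximum exceeded `sup|v(·,0)|²` it would sit at a point of `ℝ³ × (0,T]`,
where `∂ₜ|ṽ|² ≥ 0`, `⟪v, (u·∇)v⟫ = ½ u·∇|v|² = 0` and `⟪v, Δv⟫ ≤ 0` contradict the equation; hence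
`|v(x,t)|² ≤ e^{2εt} sup|v(·,0)|²` for every `ε > 0` ((4.65)), and `ε ↓ 0`.
[cite: LiuGenqian2025NSLame, proof of Thm 4.3 step 4, (4.59)–(4.65) p.28] -/
theorem driftHeatMaxPrinciple'_holds : DriftHeatMaxPrinciple' := by
  intro κ hκ T hT u v hv hunif M hM
  have hM0 : 0 ≤ M := (norm_nonneg _).trans (hM 0)
  -- (4.65): the weighted bound for every `ε > 0`
  suffices key : ∀ ε : ℝ, 0 < ε →
      ∀ t ∈ Icc 0 T, ∀ x, Real.exp (-(2 * ε * t)) * ‖v t x‖ ^ 2 ≤ M ^ 2 by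
    intro t ht x
    have hsq : ‖v t x‖ ^ 2 ≤ M ^ 2 := by
      have hc : Continuous fun ε : ℝ => Real.exp (-(2 * ε * t)) * ‖v t x‖ ^ 2 := by fun_prop
      have h0 : Tendsto (fun ε : ℝ => Real.exp (-(2 * ε * t)) * ‖v t x‖ ^ 2) (𝓝[>] 0)
          (𝓝 (‖v t x‖ ^ 2)) := by
        have := (hc.tendsto 0).mono_left (nhdsWithin_le_nhds (s := Ioi (0 : ℝ)))
        simpa using this
      exact le_of_tendsto h0 (eventually_nhdsWithin_of_forall fun ε hε => key ε hε t ht x)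
    exact (pow_le_pow_iff_left₀ (norm_nonneg _) hM0 two_ne_zero).mp hsq
  intro ε hε
  by_contra hcon
  push Not at hcon
  obtain ⟨t₁, ht₁, x₁, hlt⟩ := hcon
  -- `S' > M² ≥ 0` is a value of `|ṽ|²`; outside a large ball `|ṽ|² < S'` uniformly in `t`
  set S' : ℝ := Real.exp (-(2 * ε * t₁)) * ‖v t₁ x₁‖ ^ 2 with hS'
  have hS'pos : 0 < S' := (sq_nonneg M).trans_lt hlt
  obtain ⟨R, hR⟩ := hunif (Real.sqrt S' / 2) (by positivity)
  have hexp_le : ∀ t ∈ Icc (0 : ℝ) T, Real.exp (-(2 * ε * t)) ≤ 1 := fun t ht => by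
    rw [Real.exp_le_one_iff]
    nlinarith [ht.1]
  have hout : ∀ t ∈ Icc 0 T, ∀ x : E3, R ≤ ‖x‖ → Real.exp (-(2 * ε * t)) * ‖v t x‖ ^ 2 < S' := by
    intro t ht x hx
    have h2 : ‖v t x‖ ^ 2 ≤ (Real.sqrt S' / 2) ^ 2 := pow_le_pow_left₀ (norm_nonneg _) (hR t ht x hx) 2
    have h3 : (Real.sqrt S' / 2) ^ 2 = S' / 4 := by
      rw [div_pow, Real.sq_sqrt hS'pos.le]; norm_num
    calc Real.exp (-(2 * ε * t)) * ‖v t x‖ ^ 2 ≤ 1 * ‖v t x‖ ^ 2 := by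
          gcongr; exact hexp_le t ht
      _ < S' := by linarith
  -- the maximum over the compact part `[0,T] × B̄_{R'}` is attained at some `(t₀, x₀)`
  set R' : ℝ := max R ‖x₁‖ with hR'
  set K : Set (ℝ × E3) := Icc 0 T ×ˢ Metric.closedBall (0 : E3) R' with hK
  have hKc : IsCompact K := isCompact_Icc.prod (isCompact_closedBall _ _)
  have h1K : (t₁, x₁) ∈ K := mk_mem_prod ht₁ (by simp [hR'])
  set ψ : ℝ × E3 → ℝ := fun z => Real.exp (-(2 * ε * z.1)) * ‖v z.1 z.2‖ ^ 2 with hψ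
  have hψc : ContinuousOn ψ K := by
    have hvc : ContinuousOn (uncurry v) K :=
      hv.smooth.continuousOn.mono (prod_mono le_rfl (subset_univ _))
    have hec : Continuous fun z : ℝ × E3 => Real.exp (-(2 * ε * z.1)) := by fun_prop
    exact hec.continuousOn.mul (hvc.norm.pow 2)
  obtain ⟨⟨t₀, x₀⟩, h0K, hmaxK⟩ := hKc.exists_isMaxOn ⟨(t₁, x₁), h1K⟩ hψc
  have ht₀ : t₀ ∈ Icc 0 T := (mem_prod.mp h0K).1
  have hS'le : S' ≤ Real.exp (-(2 * ε * t₀)) * ‖v t₀ x₀‖ ^ 2 := isMaxOn_iff.mp hmaxK (t₁, x₁) h1K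
  -- `(t₀, x₀)` is a maximum point over the whole slab
  have hglob : ∀ t ∈ Icc 0 T, ∀ x : E3,
      Real.exp (-(2 * ε * t)) * ‖v t x‖ ^ 2 ≤ Real.exp (-(2 * ε * t₀)) * ‖v t₀ x₀‖ ^ 2 := by
    intro t ht x
    by_cases hx : ‖x‖ ≤ R'
    · exact isMaxOn_iff.mp hmaxK (t, x) (mk_mem_prod ht (by simpa using hx))
    · have hRx : R ≤ ‖x‖ := (le_max_left _ _).trans (not_le.mp hx).le
      exact ((hout t ht x hRx).trans_le hS'le).le
  -- `t₀ > 0`, since at `t = 0` the weighted square is `≤ M² < S'`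
  have ht₀pos : 0 < t₀ := by
    rcases ht₀.1.eq_or_lt with h | h
    · exfalso
      have h1 : Real.exp (-(2 * ε * t₀)) * ‖v t₀ x₀‖ ^ 2 ≤ M ^ 2 := by
        rw [← h]
        simp only [mul_zero, neg_zero, Real.exp_zero, one_mul]
        exact pow_le_pow_left₀ (norm_nonneg _) (hM x₀) 2
      linarith
    · exact h
  -- the slice `V = v(t₀)` and its spatial maximum at `x₀`
  have hV : ContDiff ℝ ∞ (v t₀) := hv.smooth.contDiff_slice ht₀
  have hEpos : 0 < Real.exp (-(2 * ε * t₀)) := Real.exp_pos _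
  have hxmax : ∀ x, ‖v t₀ x‖ ^ 2 ≤ ‖v t₀ x₀‖ ^ 2 := fun x =>
    le_of_mul_le_mul_left (hglob t₀ ht₀ x) hEpos
  have hV0pos : 0 < ‖v t₀ x₀‖ ^ 2 := by
    by_contra h
    have h' : ‖v t₀ x₀‖ ^ 2 = 0 := le_antisymm (not_lt.mp h) (sq_nonneg _)
    rw [h', mul_zero] at hS'le
    linarith
  -- spatial conditions (4.62)–(4.64): `⟪V, ΔV⟫ ≤ 0`, `⟪V, (u·∇)V⟫ = ½ u·∇|V|² = 0`
  have hlap : ⟪v t₀ x₀, (Δ (v t₀)) x₀⟫ ≤ 0 := inner_laplacian_nonpos_of_isMax hV hxmax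
  have hconv : ⟪v t₀ x₀, convect (u t₀) (v t₀) x₀⟫ = 0 := by
    rw [convect_apply]
    exact inner_fderiv_eq_zero_of_isMax hV hxmax _
  -- the equation at `(t₀, x₀)` gives `⟪V, ∂ₜv⟫ = κ⟪V, ΔV⟫ ≤ 0`
  have heq : timeDerivWithin (Icc 0 T) v t₀ x₀ = κ • (Δ (v t₀)) x₀ - convect (u t₀) (v t₀) x₀ := by
    have := hv.eqn t₀ ht₀ x₀
    rw [← sub_eq_zero, ← this]
    abel
  have hinner : ⟪v t₀ x₀, timeDerivWithin (Icc 0 T) v t₀ x₀⟫ ≤ 0 := by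
    rw [heq, inner_sub_right, real_inner_smul_right, hconv, sub_zero]
    nlinarith
  -- the time condition: `k(s) = e^{−2εs}|v(s,x₀)|²` is maximal over `[0,T]` at `t₀ > 0`
  have hγ : HasDerivWithinAt (fun s => v s x₀) (timeDerivWithin (Icc 0 T) v t₀ x₀) (Icc 0 T) t₀ := by
    rw [timeDerivWithin_apply]
    exact (hv.smooth.differentiableWithinAt_time ht₀ x₀).hasDerivWithinAt
  have hf : HasDerivAt (fun s : ℝ => -(2 * ε * s)) (-(2 * ε)) t₀ := by
    have h := (hasDerivAt_id t₀).const_mul (2 * ε)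
    simp only [id, mul_one] at h
    exact h.neg
  have hk : HasDerivWithinAt (fun s => Real.exp (-(2 * ε * s)) * ‖v s x₀‖ ^ 2)
      (Real.exp (-(2 * ε * t₀)) * (-(2 * ε)) * ‖v t₀ x₀‖ ^ 2 +
        Real.exp (-(2 * ε * t₀)) * (2 * ⟪v t₀ x₀, timeDerivWithin (Icc 0 T) v t₀ x₀⟫))
      (Icc 0 T) t₀ :=
    hf.exp.hasDerivWithinAt.mul hγ.norm_sq
  have htime := derivWithin_nonneg_of_isMaxOn ht₀ ht₀pos hk (fun s hs => hglob s hs x₀)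
  -- contradiction: `0 ≤ e^{−2εt₀}(−2ε|V|² + 2⟪V, ∂ₜv⟫)` with `|V(x₀)|² > 0`, `⟪V, ∂ₜv⟫ ≤ 0`
  have h1 : 0 < Real.exp (-(2 * ε * t₀)) * ε * ‖v t₀ x₀‖ ^ 2 := by positivity
  have h2 : Real.exp (-(2 * ε * t₀)) * ⟪v t₀ x₀, timeDerivWithin (Icc 0 T) v t₀ x₀⟫ ≤ 0 :=
    mul_nonpos_iff.mpr (Or.inl ⟨hEpos.le, hinner⟩)
  nlinarith

end MaxPrinciple

/-- **The printed proof of Theorem 4.3 composes from its steps, in the print's class** (p. 29, l. 2–9):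
as `theorem43_of_steps`, with Step 4′ supplying `v`, `w` in the print's class and Step 5′ — now a
theorem (`driftHeatMaxPrinciple'_holds`) — no longer a hypothesis: `Theorem43` follows from Steps 2, 4′, 6
alone, with `C = 2C₀`. [cite: LiuGenqian2025NSLame, proof of Thm 4.3 p.29 l.2–9] -/
theorem theorem43_of_steps' (h₂ : HodgeSplit) (h₄ : Thm43Decoupling') (h₆ : HodgeSupBound) :
    Theorem43 := by
  obtain ⟨C₀, hC₀⟩ := h₆
  intro μ hμ
  refine ⟨2 * C₀, ?_⟩
  intro lam hlam m hm φ hφ T hT u hu M hM t ht x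
  obtain ⟨φ₁, φ₂, hpair⟩ := h₂ φ hφ
  obtain ⟨v, w, hv, hvu, hv0, -, hw, hwu, hw0, -, hsum⟩ :=
    h₄ μ lam hμ hlam m hm φ hφ T hT u hu φ₁ φ₂ hpair
  have hb := hC₀ φ φ₁ φ₂ hφ hpair M hM
  have hκ : 0 < lam + 2 * μ := by linarith
  have h1 : ‖v t x‖ ≤ C₀ * M :=
    driftHeatMaxPrinciple'_holds μ hμ T hT u v hv hvu (C₀ * M) (fun y => by rw [hv0]; exact (hb y).1)
      t ht x
  have h2 : ‖w t x‖ ≤ C₀ * M :=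
    driftHeatMaxPrinciple'_holds (lam + 2 * μ) hκ T hT u w hw hwu (C₀ * M)
      (fun y => by rw [hw0]; exact (hb y).2) t ht x
  rw [hsum t ht x]
  calc ‖v t x + w t x‖ ≤ ‖v t x‖ + ‖w t x‖ := norm_add_le _ _
    _ ≤ C₀ * M + C₀ * M := add_le_add h1 h2
    _ = 2 * C₀ * M := by ring

/-! ## Steps 11 and 2 PROVED (D-0026 debt pass of the cell's idle default, v1.31h; typist-1 g5, CARD
custodian C09). APPEND-ONLY: no statement above is changed; verdict #10 (locator `Thm43NullSpaceV0`,
false lemma by `…Theorems.Liu2025.not_Thm43NullSpaceV0` p468189) and the addendum `not_HodgeSupBound`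
p512368 are untouched. -/

section DebtPass

open FourierNS
open scoped FourierTransform

/-- **Step 11 HOLDS (kernel)** — uniqueness within the class of Theorem 1.1 (§5, (5.38)–(5.44),
pp. 38–39: "the solution `(u_µ, p_µ)` … is unique … `u_µ ≡ ũ`") is TRUE for Clay-sense solutions
(smooth on `ℝ³ × [0,∞)`, bounded energy, datum with rapidly decaying derivatives): at `t = 0` both
velocities are the datum; for `t > 0` the second solution is a finite energy classical solution on
`[0, t]`, hence a Leray–Hopf weak solution from the datum (Tao 2013, Lemma 8.1; tree
`isLerayHopfOn_of_finiteEnergy`), so it agrees a.e. at time `t` with the first one — a Clay-class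
solution is unique within the Leray–Hopf class (Tao 2013, Cor. 11.1 + Prodi–Serrin weak–strong uniqueness;
tree `IsNavierStokesSolution.ae_eq_of_isLerayHopfOn`) — and two continuous slices that agree a.e. agree
everywhere. The printed route ((5.41)–(5.44), a Grönwall argument through Theorem 4.3) is NOT followed:
Theorem 4.3 rests on the refuted null-space sentence; the statement itself is classical. Net Literature
debt −1. [cite: LiuGenqian2025NSLame, §5 (5.38)–(5.44) pp.38–39] [cite: Tao2011, Lemma 8.1 and Cor. 11.1 (arXiv:1108.1165)] -/
theorem section5Uniqueness_holds : Section5Uniqueness := by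
  intro μ hμ φ hφ _ u₁ p₁ u₂ p₂ h₁ h₂ t ht
  obtain ⟨hU₁, hP₁, hns₁, hE₁⟩ := h₁
  obtain ⟨hU₂, hP₂, hns₂, hE₂⟩ := h₂
  rcases ht.eq_or_lt with rfl | ht0
  · rw [hns₁.initial, hns₂.initial]
  -- `u₂` is a Leray–Hopf weak solution on `[0, t)` from `φ` (Tao 2013, Lemma 8.1)
  have hcl₂ : IsClassicalNSSolutionOn (Icc 0 t) μ 0 u₂ p₂ := hns₂.isClassicalNSSolutionOn_Icc hU₂ hP₂ ht0
  have hfe₂ : ∃ A : ℝ≥0∞, A < ⊤ ∧ ∀ s ∈ Icc 0 t, ∫⁻ x, ‖u₂ s x‖ₑ ^ 2 ≤ A := by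
    obtain ⟨C, hC, hb⟩ := hE₂
    exact ⟨C, hC, fun s hs => hb s hs.1⟩
  have hLH₂ : IsLerayHopfOn t μ 0 φ u₂ := by
    have h := (isLerayHopfOn_of_finiteEnergy hcl₂ hμ ht0 hfe₂).1
    rwa [hns₂.initial] at h
  -- a Clay-class solution is unique within the Leray–Hopf class (Tao 2013, Cor. 11.1 + Prodi–Serrin)
  have hae : u₂ t =ᵐ[volume] u₁ t :=
    hns₁.ae_eq_of_isLerayHopfOn hμ ht0 hφ.2 hU₁ hP₁ hE₁ hLH₂ t ⟨ht0, le_rfl⟩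
  have hc₁ : Continuous (u₁ t) :=
    (IsSmoothSpaceTimeOn.contDiff_slice (S := Ici 0) (w := u₁) hU₁ ht).continuous
  have hc₂ : Continuous (u₂ t) :=
    (IsSmoothSpaceTimeOn.contDiff_slice (S := Ici 0) (w := u₂) hU₂ ht).continuous
  exact ((Continuous.ae_eq_iff_eq volume hc₂ hc₁).1 hae).symm

/-- `Section5Uniqueness` — `_holds` alias of `section5Uniqueness_holds` above under the fact's exact name (appended
2026-08-28, D-0026 bookkeeping: the proof term is the existing theorem of this file; no statement,
definition or attribute is edited; no new named fact; the ledger's debt table listed the fact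
unproved). [cite: Tao2011, Lemma 8.1 and Cor. 11.1 (arXiv:1108.1165)] -/
theorem _root_.Literature.Claims.NS.Liu2025.Section5Uniqueness_holds : Section5Uniqueness :=
  _root_.Literature.Claims.NS.Liu2025.section5Uniqueness_holds

/-- Riemann–Lebesgue for synthesized fields: `synthVel V = Re 𝓕 V → 0` at spatial infinity (each
component `𝓕 Vₗ` tends to `0` along the cocompact filter — Mathlib's
`tendsto_integral_exp_inner_smul_cocompact`, unconditionally — and `Re` is continuous linear). [folklore] -/
private theorem vanishesAtInfinity_synthVel (V : E3 → Fin 3 → ℂ) : VanishesAtInfinity (synthVel V) := by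
  have h1 : Tendsto (fun x => fun l => 𝓕 (fun ξ => V ξ l) x) (cocompact E3) (𝓝 0) :=
    tendsto_pi_nhds.2 fun l => tendsto_integral_exp_inner_smul_cocompact (fun ξ => V ξ l)
  have h2 := ((ClayDatum.reVec (ι := Fin 3)).continuous.tendsto 0).comp h1
  rw [map_zero] at h2
  rw [VanishesAtInfinity, synthVel_eq_comp]
  exact h2

/-- **Step 2 HOLDS (kernel)** — the Hodge decomposition (4.19)–(4.21) of a Schwartz field (p. 22: "It
follows from the Hodge decomposition … `ϕ = ϕ₁ + ϕ₂`, `div ϕ₁ = 0` and `curl ϕ₂ = 0`, where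
`ϕ₁, ϕ₂ ∈ C₀(ℝ³) ∩ C^∞(ℝ³)`"): `ϕ₂ = ∇Δ⁻¹ div ϕ`, `ϕ₁ = ϕ − ϕ₂ = P ϕ` (Leray projection). Proof on the
Fourier side with the tree's static Fourier–Leray machinery (Tao 2013, (8): `P = Id − ∇Δ⁻¹div` with
symbol `δⱼₖ − ξⱼξₖ/|ξ|²`): `g = 𝓕⁻ϕ` (`fourierData`, Schwartz, every polynomial decay), the pressure-like
potential `q = Re 𝓕 forcePresSymbol g` is `C^∞` (`contDiff_forcePressure`) with
`∇q = Re 𝓕 g − Re 𝓕 (lerayPart g) = ϕ − P ϕ` (`gradient_forcePressure`, `fourier_fourierData`);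
`P ϕ = Re 𝓕 (lerayPart g)` is divergence free (`isDivFree_synthVel_of_decay`, `Σₗ ξₗ (lerayPart g)ₗ = 0`)
and vanishes at infinity (Riemann–Lebesgue, `vanishesAtInfinity_synthVel`); `curl ∇q = 0` for the `C²`
potential (`curl_gradient_eq_zero_holds`, Schwarz); `∇q = ϕ − P ϕ → 0` at infinity since `ϕ` does
(rapid decay). Net Literature debt −1; after this and Step 5′, `theorem43_of_steps'` rests on Step 4′
`Thm43Decoupling'` and the kernel-false Step 6 `HodgeSupBound` only.
[cite: LiuGenqian2025NSLame, (4.19)–(4.21) p.22] [cite: Tao2011, (8) p. 3] [cite: LemarieRieusset2016, §6.1] -/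
theorem hodgeSplit_holds : HodgeSplit := by
  intro φ hφ
  obtain ⟨hsm, hdec⟩ := hφ
  -- the Fourier datum `g = 𝓕⁻ φ` of the Schwartz field and the potential `q = Δ⁻¹ div φ`
  set g : E3 → Fin 3 → ℂ := fourierData hsm hdec with hg
  set q : E3 → ℝ := fun y => (𝓕 (forcePresSymbol g) y).re with hq
  have hgm : ∀ k, AEStronglyMeasurable (fun ξ => g ξ k) volume := fun k =>
    ((continuous_apply k).comp (continuous_fourierData hsm hdec)).aestronglyMeasurable
  have hdecg : ∀ K : ℕ, ∃ B, HasDecay K B g := fun K => hasDecay_fourierData hsm hdec K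
  -- (i) the synthesis of the datum is the field: `Re 𝓕 g = φ`
  have hsynth : synthVel g = φ := by
    funext x
    ext l
    rw [synthVel_apply, hg, congrFun (fourier_fourierData hsm hdec l) x, Complex.ofReal_re]
  -- (ii) `∇q = φ − P φ`
  obtain ⟨B, hB⟩ := hdecg (1 + 5)
  have hgrad : ∀ x, gradient q x = φ x - synthVel (lerayPart g) x := by
    intro x
    rw [hq, gradient_forcePressure hB le_rfl hgm x, hsynth]
  -- (iii) smoothness of the potential and of its gradient
  have hq_smooth : ContDiff ℝ ∞ q := contDiff_forcePressure hdecg hgm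
  have hgq_smooth : ContDiff ℝ ∞ (gradient q) := by
    have e : gradient q = fun x => (InnerProductSpace.toDual ℝ E3).symm (fderiv ℝ q x) := rfl
    rw [e]
    exact (InnerProductSpace.toDual ℝ E3).symm.contDiff.comp (contDiff_infty_iff_fderiv.1 hq_smooth).2
  -- (iv) `P φ` is divergence free (Fourier side: `Σₗ ξₗ (lerayPart g)ₗ = 0`)
  obtain ⟨B', hB'⟩ := hdecg (1 + (Fintype.card (Fin 3) + 1))
  have hdivP : VectorCalculus.IsDivFree (synthVel (lerayPart g)) :=
    isDivFree_synthVel_of_decay (hasDecay_lerayPart hB') (aestronglyMeasurable_lerayPart_apply hgm)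
      (sum_mul_lerayPart g)
  -- the pair `(φ − ∇q, ∇q) = (P φ, ∇Δ⁻¹ div φ)`
  have hφ₁ : (fun x => φ x - gradient q x) = synthVel (lerayPart g) := by
    funext x
    rw [hgrad x, sub_sub_cancel]
  refine ⟨fun x => φ x - gradient q x, gradient q, hsm.sub hgq_smooth, hgq_smooth, ?_, ?_,
    fun x => (sub_add_cancel (φ x) (gradient q x)).symm, ?_, ?_⟩
  · -- `P φ → 0` at infinity (Riemann–Lebesgue)
    rw [hφ₁]
    exact vanishesAtInfinity_synthVel _
  · -- `∇q = φ − P φ → 0` at infinity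
    have h1 := (vanishesAtInfinity_of_hasRapidSpatialDecay hdec).sub
      (vanishesAtInfinity_synthVel (lerayPart g))
    rw [sub_zero] at h1
    refine h1.congr fun x => ?_
    rw [hgrad x]
  · -- `div P φ = 0`
    rw [hφ₁]
    exact hdivP
  · -- `curl ∇q = 0` (Schwarz)
    intro x
    have hq2 : ContDiff ℝ 2 q := hq_smooth.of_le (by norm_cast)
    exact curl_gradient_eq_zero_holds q hq2 x

/-- `HodgeSplit` — `_holds` alias of `hodgeSplit_holds` above under the fact's exact name (appended
2026-08-28, D-0026 bookkeeping: the proof term is the existing theorem of this file; no statement,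
definition or attribute is edited; no new named fact; the ledger's debt table listed the fact
unproved). [cite: LemarieRieusset2016, §6.1] -/
theorem _root_.Literature.Claims.NS.Liu2025.HodgeSplit_holds : HodgeSplit :=
  _root_.Literature.Claims.NS.Liu2025.hodgeSplit_holds

end DebtPass

end Literature.Claims.NS.Liu2025

end

-- WHAT THIS IS NOT: not a claim about NS regularity or blow-up; not a claim about any author beyond the
-- typed locator.
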